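import Summits.ABC.ABC.Theses.CuspFieldPencil
import Literature.NumberTheory.DiophantineGeometry.AbcWave0GranvilleStarkHeights
import Mathlib.NumberTheory.Height.MvPolynomial
import HarnessLib

/-!
# Number-field pencil theorem: bookkeeping lemmas (radical norms, gcd division, heights)

`Summits/ABC/ABC/Theorems/CuspFieldPencilNFPencilLemmas.lean` — helper lemmas toward the crux
stmt-ABC-26250 `Summit.ABC.ABC.Theses.CuspFieldPencil.NFPencilBound` (draft class-record route
`CuspFieldPencil`, LINE 17), all UNCONDITIONAL and elementary:

* §1 radical norms in a ring of integers: `absNorm_radical_span_mul_le`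
  (`N(rad(xy)) ≤ N(rad x)·N(rad y)`), `radicalNorm_le_absNorm_radical` (Granville–Stark's conductor
  `N_K(a,b,c) ≤ N(rad(abc·𝓞_K))` for nonzero integers, class number one);
* §2 gcd division in a principal ideal domain: `exists_coprime_triple` (`A₀ + A₁ + A₂ = 0`, all
  nonzero ⇒ `Aᵢ = g·aᵢ` with `a₀ + a₁ + a₂ = 0` pairwise coprime);
* §3 heights: `log_max_le_logHeight_pair` (`log max(|u|,|w|) ≤ log H_K(u : w)` for coprime
  integers `u, w`, any number field `K`).

HONESTY. Elementary bookkeeping for a CLASS RECORD at abc distance 0 (width 0); proves no item by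
itself; NOT abc, NOT A-PS; abc moved by 0; typed ≠ proved.

References: Marcus, *Number Fields* Ch. 3; Bombieri–Gubler, *Heights* §1.5; [folklore].
-/

set_option linter.dupNamespace false

namespace Summit.ABC.ABC.Theorems

open NumberField Height

namespace NFPencilLemmas

/-! ## §1 Radical norms -/

/-- `N(rad((xy))) ≤ N(rad((x)))·N(rad((y)))` for `x ≠ 0` in a Dedekind domain with finite quotients
(`rad(x)·rad(y) = (rad x ⊔ rad y)·rad(xy)` and `N(rad x ⊔ rad y) ≥ 1`). [folklore] -/
theorem absNorm_radical_span_mul_le {R : Type*} [CommRing R] [IsDedekindDomain R]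
    [Module.Free ℤ R] [Module.Finite ℤ R] {x : R} (hx : x ≠ 0) (y : R) :
    Ideal.absNorm (Ideal.span {x * y}).radical ≤
      Ideal.absNorm (Ideal.span {x}).radical * Ideal.absNorm (Ideal.span {y}).radical := by
  have hid : Ideal.absNorm (Ideal.span {x}).radical * Ideal.absNorm (Ideal.span {y}).radical =
      Ideal.absNorm ((Ideal.span {x}).radical ⊔ (Ideal.span {y}).radical) *
        Ideal.absNorm (Ideal.span {x * y}).radical := by
    rw [← map_mul, ← Ideal.sup_mul_inf, map_mul, ← Ideal.span_singleton_mul_span_singleton,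
      Ideal.radical_mul, ← Ideal.radical_inf]
  rw [hid]
  refine Nat.le_mul_of_pos_left _ (Nat.pos_of_ne_zero ?_)
  rw [Ne, Ideal.absNorm_eq_zero_iff]
  intro h
  have h1 : (Ideal.span {x}).radical = ⊥ := le_bot_iff.mp (le_sup_left.trans h.le)
  have h2 : Ideal.span {x} = ⊥ := le_bot_iff.mp (Ideal.le_radical.trans h1.le)
  exact hx (Ideal.span_singleton_eq_bot.mp h2)

/-- `N(rad((xyz))) ≤ N(rad x)·N(rad y)·N(rad z)` for `x, y ≠ 0`. [folklore] -/
theorem absNorm_radical_span_mul_mul_le {R : Type*} [CommRing R] [IsDedekindDomain R]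
    [Module.Free ℤ R] [Module.Finite ℤ R] {x y : R} (hx : x ≠ 0) (hy : y ≠ 0) (z : R) :
    Ideal.absNorm (Ideal.span {x * y * z}).radical ≤
      Ideal.absNorm (Ideal.span {x}).radical * Ideal.absNorm (Ideal.span {y}).radical *
        Ideal.absNorm (Ideal.span {z}).radical :=
  (absNorm_radical_span_mul_le (mul_ne_zero hx hy) z).trans
    (Nat.mul_le_mul_right _ (absNorm_radical_span_mul_le hx y))

/-- If `x ∣ y` and `y ≠ 0` then `N(rad((x))) ≤ N(rad((y)))`. [folklore] -/
theorem absNorm_radical_span_le_of_dvd {R : Type*} [CommRing R] [IsDedekindDomain R]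
    [Module.Free ℤ R] [Module.Finite ℤ R] {x y : R} (hxy : x ∣ y) (hy : y ≠ 0) :
    Ideal.absNorm (Ideal.span {x}).radical ≤ Ideal.absNorm (Ideal.span {y}).radical := by
  have hle : (Ideal.span {y}).radical ≤ (Ideal.span {x}).radical :=
    Ideal.radical_mono (Ideal.span_singleton_le_span_singleton.mpr hxy)
  refine Nat.le_of_dvd (Nat.pos_of_ne_zero ?_) (Ideal.absNorm_dvd_absNorm_of_le hle)
  rw [Ne, Ideal.absNorm_eq_zero_iff]
  intro h
  exact hy (Ideal.span_singleton_eq_bot.mp (le_bot_iff.mp (Ideal.le_radical.trans h.le)))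

/-- **Granville–Stark conductor vs radical norm** (class number one): for nonzero `a, b, c ∈ 𝓞_K`,
`N_K(a, b, c) = ∏_{𝔭 bad} N𝔭 ≤ N(rad(abc·𝓞_K))` — every bad prime contains `abc`, hence the
generator `s` of the principal ideal `rad(abc·𝓞_K)`, and the distinct primes containing `s` have
product dividing `(s)`. [folklore] -/
theorem radicalNorm_le_absNorm_radical {K : Type*} [Field K] [NumberField K]
    (hPID : IsPrincipalIdealRing (𝓞 K)) {a b c : 𝓞 K} (habc : a * b * c ≠ 0) :
    Literature.NumberTheory.DiophantineGeometry.radicalNorm (a : K) b c ≤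
      Ideal.absNorm (Ideal.span {a * b * c}).radical := by
  haveI := hPID
  obtain ⟨s, hs⟩ := (IsPrincipalIdealRing.principal (Ideal.span {a * b * c}).radical).principal
  have hs' : (Ideal.span {a * b * c}).radical = Ideal.span {s} := hs
  have hs0 : s ≠ 0 := by
    intro h0
    rw [h0, Ideal.span_singleton_zero] at hs'
    have : Ideal.span {a * b * c} = ⊥ := le_bot_iff.mp (Ideal.le_radical.trans hs'.le)
    exact habc (Ideal.span_singleton_eq_bot.mp this)
  rw [hs']
  refine Literature.NumberTheory.DiophantineGeometry.radicalNorm_le_absNorm_span hs0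
    (Literature.NumberTheory.DiophantineGeometry.badPrimes_subset_of_forall fun v hsv => ?_)
  -- if `s ∉ 𝔭` then `abc ∉ 𝔭`, so none of `a, b, c` lies in `𝔭`
  have habc' : a * b * c ∉ v.asIdeal := by
    intro hmem
    apply hsv
    have h1 : (Ideal.span {a * b * c}).radical ≤ v.asIdeal :=
      (Ideal.IsPrime.radical_le_iff v.isPrime).mpr ((Ideal.span_singleton_le_iff_mem _).mpr hmem)
    rw [hs'] at h1
    exact (Ideal.span_singleton_le_iff_mem _).mp h1
  refine ⟨fun ha => habc' ?_, fun hb => habc' ?_, fun hc => habc' ?_⟩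
  · rw [mul_assoc]; exact v.asIdeal.mul_mem_right _ ha
  · rw [mul_comm a b, mul_assoc]; exact v.asIdeal.mul_mem_right _ hb
  · exact v.asIdeal.mul_mem_left _ hc

/-! ## §2 gcd division in a principal ideal domain -/

/-- In a principal ideal domain, a vanishing sum `A₀ + A₁ + A₂ = 0` of nonzero elements is `g` times
a vanishing sum `a₀ + a₁ + a₂ = 0` of pairwise coprime nonzero elements (`g` a generator of
`(A₀, A₁)`). [folklore] -/
theorem exists_coprime_triple {R : Type*} [CommRing R] [IsDomain R] [IsPrincipalIdealRing R]
    {A₀ A₁ A₂ : R} (h₀ : A₀ ≠ 0) (h₁ : A₁ ≠ 0) (h₂ : A₂ ≠ 0) (hsum : A₀ + A₁ + A₂ = 0) :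
    ∃ g a b c : R, g ≠ 0 ∧ A₀ = g * a ∧ A₁ = g * b ∧ A₂ = g * c ∧ a ≠ 0 ∧ b ≠ 0 ∧ c ≠ 0 ∧
      a + b + c = 0 ∧ IsCoprime a b ∧ IsCoprime b c ∧ IsCoprime c a := by
  obtain ⟨g, hg⟩ := (IsPrincipalIdealRing.principal (Ideal.span ({A₀, A₁} : Set R))).principal
  have hg' : Ideal.span ({A₀, A₁} : Set R) = Ideal.span {g} := hg
  have hA₀ : g ∣ A₀ := Ideal.mem_span_singleton.mp (hg' ▸ Ideal.subset_span (by simp))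
  have hA₁ : g ∣ A₁ := Ideal.mem_span_singleton.mp (hg' ▸ Ideal.subset_span (by simp))
  obtain ⟨a, ha⟩ := hA₀
  obtain ⟨b, hb⟩ := hA₁
  have hgmem : g ∈ Ideal.span ({A₀, A₁} : Set R) := hg' ▸ Ideal.mem_span_singleton_self g
  obtain ⟨x, y, hxy⟩ := Ideal.mem_span_pair.mp hgmem
  have hg0 : g ≠ 0 := fun h => h₀ (by rw [ha, h, zero_mul])
  have hab : IsCoprime a b := by
    refine ⟨x, y, mul_left_cancel₀ hg0 ?_⟩
    rw [mul_one]
    calc g * (x * a + y * b) = x * (g * a) + y * (g * b) := by ring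
      _ = g := by rw [← ha, ← hb, hxy]
  refine ⟨g, a, b, -(a + b), hg0, ha, hb, ?_, ?_, ?_, ?_, by ring, hab, ?_, ?_⟩
  · have : A₂ = -(A₀ + A₁) := by linear_combination hsum
    rw [this, ha, hb]; ring
  · intro h; exact h₀ (by rw [ha, h, mul_zero])
  · intro h; exact h₁ (by rw [hb, h, mul_zero])
  · intro h
    have hab0 : a + b = 0 := neg_eq_zero.mp h
    apply h₂
    linear_combination hsum - ha - hb - g * hab0
  · have h1 : IsCoprime b (-a) := hab.symm.neg_right
    have h2 : -(a + b) = -a + b * (-1) := by ring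
    rw [h2]; exact h1.add_mul_left_right _
  · have h1 : IsCoprime a (-b) := hab.neg_right
    have h2 : -(a + b) = -b + a * (-1) := by ring
    rw [h2]; exact (h1.add_mul_left_right _).symm

/-! ## §3 Heights of coprime integer pairs over a number field -/

/-- For coprime integers `u, w` and any number field `K`:
`log max(|u|, |w|) ≤ log H_K(u : w)` — the finite part of Mathlib's relative height of the
primitive pair is `1` (`N((u, w)) = 1`), and each archimedean factor is `max(|u|,|w|) ≥ 1`, with
`∑ mult = [K:ℚ] ≥ 1`. [folklore] -/
theorem log_max_le_logHeight_pair (K : Type*) [Field K] [NumberField K] {u w : ℤ}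
    (hcop : IsCoprime u w) :
    Real.log ((max |u| |w| : ℤ) : ℝ) ≤ logHeight ![(u : K), (w : K)] := by
  classical
  -- integral model of the pair
  set x : Fin 2 → 𝓞 K := ![(u : 𝓞 K), (w : 𝓞 K)] with hxdef
  have hne : u ≠ 0 ∨ w ≠ 0 := by
    by_contra h
    push Not at h
    obtain ⟨p, q, hpq⟩ := hcop
    rw [h.1, h.2] at hpq; simp at hpq
  set xK : Fin 2 → K := fun i => (x i : K) with hxK
  have hxK_eq : xK = ![(u : K), (w : K)] := by
    ext i; fin_cases i <;> simp [hxK, hxdef]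
  have hx0 : x ≠ 0 := by
    intro h
    rcases hne with hu | hw
    · have := congrFun h 0; simp [hxdef] at this; exact hu this
    · have := congrFun h 1; simp [hxdef] at this; exact hw this
  have hxK0 : xK ≠ 0 := by
    intro h
    rcases hne with hu | hw
    · have := congrFun h 0; simp [hxK, hxdef] at this; exact hu this
    · have := congrFun h 1; simp [hxK, hxdef] at this; exact hw this
  -- the real number `M = max(|u|,|w|) ≥ 1`
  set M : ℝ := ((max |u| |w| : ℤ) : ℝ) with hM
  have hM1 : 1 ≤ M := by
    rw [hM]
    have : (1 : ℤ) ≤ max |u| |w| := by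
      rcases hne with hu | hw
      · exact (Int.one_le_abs hu).trans (le_max_left _ _)
      · exact (Int.one_le_abs hw).trans (le_max_right _ _)
    exact_mod_cast this
  have hM0 : 0 < M := one_pos.trans_le hM1
  rw [logHeight_eq_log_mulHeight, ← hxK_eq]
  apply Real.log_le_log hM0
  rw [NumberField.mulHeight_eq hxK0]
  -- finite part `= 1`
  have hfin := NumberField.absNorm_mul_finprod_finitePlace_eq_one hx0
  have hspan : Ideal.span (Set.range x) = ⊤ := by
    rw [Ideal.eq_top_iff_one]
    obtain ⟨p, q, hpq⟩ := hcop
    have h1 : (1 : 𝓞 K) = (p : 𝓞 K) * x 0 + (q : 𝓞 K) * x 1 := by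
      simp only [hxdef, Matrix.cons_val_zero, Matrix.cons_val_one]
      rw [← Int.cast_mul, ← Int.cast_mul, ← Int.cast_add, hpq, Int.cast_one]
    rw [h1]
    exact Ideal.add_mem _ (Ideal.mul_mem_left _ _ (Ideal.subset_span ⟨0, rfl⟩))
      (Ideal.mul_mem_left _ _ (Ideal.subset_span ⟨1, rfl⟩))
  rw [hspan, Ideal.absNorm_top, Nat.cast_one, one_mul] at hfin
  have hfin' : ∏ᶠ v : FinitePlace K, ⨆ i, v (xK i) = 1 := hfin
  rw [hfin', mul_one]
  -- archimedean part `≥ M ^ [K:ℚ] ≥ M`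
  have hv : ∀ v : InfinitePlace K, M ≤ ⨆ i, v (xK i) := by
    intro v
    have hu' : v (xK 0) = |(u : ℝ)| := by
      simp only [hxK, hxdef, Matrix.cons_val_zero]
      rw [show ((u : 𝓞 K) : K) = ((u : ℤ) : K) from map_intCast _ u, InfinitePlace.map_intCast,
        Int.norm_eq_abs]
    have hw' : v (xK 1) = |(w : ℝ)| := by
      simp only [hxK, hxdef, Matrix.cons_val_one, Matrix.cons_val_fin_one]
      rw [show ((w : 𝓞 K) : K) = ((w : ℤ) : K) from map_intCast _ w, InfinitePlace.map_intCast,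
        Int.norm_eq_abs]
    rw [hM]; push_cast
    refine max_le ?_ ?_
    · rw [← hu']; exact Finite.le_ciSup_of_le 0 le_rfl
    · rw [← hw']; exact Finite.le_ciSup_of_le 1 le_rfl
  have hsum : ∑ v : InfinitePlace K, v.mult = Module.finrank ℚ K := by
    rw [← NumberField.totalWeight_eq_sum_mult, NumberField.totalWeight_eq_finrank]
  have hd : 1 ≤ Module.finrank ℚ K := Module.finrank_pos
  calc M = M ^ 1 := (pow_one M).symm
    _ ≤ M ^ Module.finrank ℚ K := pow_le_pow_right₀ hM1 hd
    _ = ∏ v : InfinitePlace K, M ^ v.mult := by rw [Finset.prod_pow_eq_pow_sum, hsum]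
    _ ≤ ∏ v : InfinitePlace K, (⨆ i, v (xK i)) ^ v.mult :=
        Finset.prod_le_prod (fun v _ => pow_nonneg hM0.le _) fun v _ =>
          pow_le_pow_left₀ hM0.le (hv v) _

end NFPencilLemmas

end Summit.ABC.ABC.Theorems
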